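import Literature.GroupTheory.SpecificGroups.PadicQuadraticOneUnits
import HarnessLib

/-!
# The quadratic `p`-adic affine carrier `ℤ_p[√p] ⋊ (U_ℝ × U)`: a compact totally disconnected group whose
# «arithmetic» scalings form an anisotropic torus and whose «geometric» scalings form the real line

Topic `Literature/GroupTheory/SpecificGroups`; continues `PadicQuadraticOneUnits.lean` (`R = ℤ_p[√p]`,
`U = 1 + πR`, `U_ℝ = U ∩ ℤ_p`) in the format of `PadicAffineGroup.lean`:

* `PadicQuadAffine p` — the affine carrier `G = R ⋊ (U_ℝ × U)`: triples `(a, w, u)` with `a ∈ R`, `w ∈ U` real,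
  `u ∈ U`, acting on `R` by `y ↦ w·u·y + a` (`act`), multiplication `(a, w, u)(a′, w′, u′) = (a + w u a′, w w′, u u′)`;
  a compact Hausdorff totally disconnected topological group;
* the AUGMENTATION `aug : G →* U`, `(a, w, u) ↦ u` (continuous, surjective, section `ofUnit`) and the point
  STABILISERS `stab y = {g : g · y = y}` (`g · Stab(y) · g⁻¹ = Stab(g · y)`); closedness of stabilisers, the real
  line and the level subgroup `πR ⋊ (U_ℝ × U)` follow in `PadicQuadraticAffineLevel.lean`.  The elements `(0, w, w⁻¹)` act trivially on `R`: the real scalings occur twice, once «geometrically» (`w`,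
  inside `ker aug`) and once «arithmetically» (inside `U`), so that `G ≅ (R ⋊ U) ×_{U/U_ℝ} U` is the pull-back
  of the outer action of `U` on `R ⋊ U_ℝ`, whose kernel is exactly `U_ℝ`.

(Elementary computations carried out here — OUR kernel check, no published claim asserted; the `[cite: …]` tags
locate the DEFINITIONS the carrier instantiates: [SemiAnbd] §5 Def 5.3 p. 65, decomposition data
`Π^temp_{𝔊,b} ⊆ Π^temp_{𝔊,v}` with augmentation `Π^temp_𝔊 ↠ Π_A`.)  Purpose (cell abc-iut, layer L3, row
«NV-T54-RESIDUAL stage 1», design credit abc-iut-w4-d029 gen 6 HANDOFF #2): the carrier of the joint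
non-vacuity witness `Literature/AnabelianGeometry/SemiGraphs/ArithTotalEstrangementTransportWitness.lean`
(total arithmetic estrangement TOGETHER WITH branch transport and a non-split action).  Mathlib only: no
statement of any IUT paper is touched here; no side is taken on [IUTchIII] Cor 3.12.
-/

noncomputable section

namespace Literature.GroupTheory.SpecificGroups

open Topology Filter Set
open scoped QuadraticAlgebra

variable (p : ℕ) [Fact p.Prime]


/-! ### The affine carrier `G = R ⋊ (U_ℝ × U)` -/

/-- The quadratic `p`-adic affine carrier: triples `(a, w, u)` with `a ∈ R = ℤ_p[√p]`, `w ∈ U` REAL and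
`u ∈ U`, i.e. the substitution `y ↦ w u y + a` of `R` remembering the factorisation of its linear part
into a «geometric» real scaling `w` and an «arithmetic» scaling `u`. [cite: MochizukiSemiAnbd2006, Def 5.3 (i), p. 65] -/
@[ext] structure PadicQuadAffine : Type where
  /-- the translation part `a ∈ ℤ_p[√p]` -/
  a : PadicQuad p
  /-- the geometric (real) scaling -/
  w : PadicQuadOneUnits p
  /-- the arithmetic scaling -/
  u : PadicQuadOneUnits p
  /-- `w` is real -/
  w_real : w.val.im = 0

namespace PadicQuadAffine

variable {p}

/-- The linear part `w u ∈ R` of `(a, w, u)`. [cite: MochizukiSemiAnbd2006, Def 5.3 (i), p. 65] -/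
def lin (g : PadicQuadAffine p) : PadicQuad p := g.w.val * g.u.val

/-- Multiplication `(a, w, u)(a′, w′, u′) = (a + w u a′, w w′, u u′)`. [cite: MochizukiSemiAnbd2006, Def 5.3 (i), p. 65] -/
instance : Mul (PadicQuadAffine p) :=
  ⟨fun g h => ⟨g.a + g.lin * h.a, g.w * h.w, g.u * h.u, by
    simp [QuadraticAlgebra.im_mul, g.w_real, h.w_real]⟩⟩

/-- The unit `(0, 1, 1)`. [cite: MochizukiSemiAnbd2006, Def 5.3 (i), p. 65] -/
instance : One (PadicQuadAffine p) := ⟨⟨0, 1, 1, by simp [QuadraticAlgebra.im_one]⟩⟩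

/-- Inversion `(a, w, u)⁻¹ = (−(w u)⁻¹ a, w⁻¹, u⁻¹)`. [cite: MochizukiSemiAnbd2006, Def 5.3 (i), p. 65] -/
instance : Inv (PadicQuadAffine p) :=
  ⟨fun g => ⟨-(g.w⁻¹.val * g.u⁻¹.val * g.a), g.w⁻¹, g.u⁻¹, by
    simp [PadicQuadOneUnits.val_inv, QuadraticAlgebra.algebraMap_eq, g.w_real]⟩⟩

/-- Translation part of a product. [cite: MochizukiSemiAnbd2006, Def 5.3 (i), p. 65] -/
@[simp] theorem mul_a (g h : PadicQuadAffine p) : (g * h).a = g.a + g.lin * h.a := rfl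
/-- Real scaling of a product. [cite: MochizukiSemiAnbd2006, Def 5.3 (i), p. 65] -/
@[simp] theorem mul_w (g h : PadicQuadAffine p) : (g * h).w = g.w * h.w := rfl
/-- Arithmetic scaling of a product. [cite: MochizukiSemiAnbd2006, Def 5.3 (i), p. 65] -/
@[simp] theorem mul_u (g h : PadicQuadAffine p) : (g * h).u = g.u * h.u := rfl
/-- Translation part of `1`. [cite: MochizukiSemiAnbd2006, Def 5.3 (i), p. 65] -/
@[simp] theorem one_a : (1 : PadicQuadAffine p).a = 0 := rfl
/-- Real scaling of `1`. [cite: MochizukiSemiAnbd2006, Def 5.3 (i), p. 65] -/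
@[simp] theorem one_w : (1 : PadicQuadAffine p).w = 1 := rfl
/-- Arithmetic scaling of `1`. [cite: MochizukiSemiAnbd2006, Def 5.3 (i), p. 65] -/
@[simp] theorem one_u : (1 : PadicQuadAffine p).u = 1 := rfl
/-- Translation part of the inverse. [cite: MochizukiSemiAnbd2006, Def 5.3 (i), p. 65] -/
@[simp] theorem inv_a (g : PadicQuadAffine p) : g⁻¹.a = -(g.w⁻¹.val * g.u⁻¹.val * g.a) := rfl
/-- Real scaling of the inverse. [cite: MochizukiSemiAnbd2006, Def 5.3 (i), p. 65] -/
@[simp] theorem inv_w (g : PadicQuadAffine p) : g⁻¹.w = g.w⁻¹ := rfl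
/-- Arithmetic scaling of the inverse. [cite: MochizukiSemiAnbd2006, Def 5.3 (i), p. 65] -/
@[simp] theorem inv_u (g : PadicQuadAffine p) : g⁻¹.u = g.u⁻¹ := rfl
/-- Linear part of a product. [cite: MochizukiSemiAnbd2006, Def 5.3 (i), p. 65] -/
@[simp] theorem lin_mul (g h : PadicQuadAffine p) : (g * h).lin = g.lin * h.lin := by
  simp only [lin, mul_w, mul_u, PadicQuadOneUnits.val_mul]; ring
/-- Linear part of `1`. [cite: MochizukiSemiAnbd2006, Def 5.3 (i), p. 65] -/
@[simp] theorem lin_one : (1 : PadicQuadAffine p).lin = 1 := by simp [lin]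
/-- Linear part of the inverse times the linear part. [cite: MochizukiSemiAnbd2006, Def 5.3 (i), p. 65] -/
@[simp] theorem lin_inv_mul_lin (g : PadicQuadAffine p) : g⁻¹.lin * g.lin = 1 := by
  simp only [lin, inv_w, inv_u]
  calc g.w⁻¹.val * g.u⁻¹.val * (g.w.val * g.u.val)
      = (g.w⁻¹.val * g.w.val) * (g.u⁻¹.val * g.u.val) := by ring
    _ = 1 := by simp

/-- The carrier is a group (the semidirect product `R ⋊ (U_ℝ × U)`). [cite: MochizukiSemiAnbd2006, Def 5.3 (i), p. 65] -/
instance : Group (PadicQuadAffine p) where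
  mul_assoc x y z := by
    ext1
    · simp only [mul_a, lin_mul]; ring
    · simp only [mul_w, mul_assoc]
    · simp only [mul_u, mul_assoc]
  one_mul x := by ext1 <;> simp
  mul_one x := by ext1 <;> simp
  inv_mul_cancel x := by
    ext1
    · simp only [mul_a, inv_a, one_a, lin, inv_w, inv_u]
      ring
    · simp
    · simp

/-- The linear part is the value of `1` under the affine action minus the translation: `lin g⁻¹ = (lin g)⁻¹`
in the form `lin g * lin g⁻¹ = 1`. [cite: MochizukiSemiAnbd2006, Def 5.3 (i), p. 65] -/
@[simp] theorem lin_mul_lin_inv (g : PadicQuadAffine p) : g.lin * g⁻¹.lin = 1 := by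
  rw [mul_comm, lin_inv_mul_lin]

/-! #### Topology: the coordinates `(a.re, a.im, w, u)` -/

/-- The coordinate map into `ℤ_p × ℤ_p × U × U`. [cite: MochizukiSemiAnbd2006, Def 5.3 (i), p. 65] -/
def coord (g : PadicQuadAffine p) : (ℤ_[p] × ℤ_[p]) × (PadicQuadOneUnits p × PadicQuadOneUnits p) :=
  ((g.a.re, g.a.im), (g.w, g.u))

/-- The coordinate map is injective. [cite: MochizukiSemiAnbd2006, Def 5.3 (i), p. 65] -/
theorem coord_injective : Function.Injective (coord (p := p)) := by
  intro g h e
  simp only [coord, Prod.mk.injEq] at e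
  exact PadicQuadAffine.ext (QuadraticAlgebra.ext e.1.1 e.1.2) e.2.1 e.2.2

/-- The range of the coordinates: the closed set `{w real}`. [cite: MochizukiSemiAnbd2006, Def 5.3 (i), p. 65] -/
theorem range_coord : range (coord (p := p)) = {q | q.2.1.val.im = 0} := by
  ext q
  constructor
  · rintro ⟨g, rfl⟩
    exact g.w_real
  · intro hq
    exact ⟨⟨⟨q.1.1, q.1.2⟩, q.2.1, q.2.2, hq⟩, rfl⟩

/-- The topology: induced by the coordinates. [cite: MochizukiSemiAnbd2006, Def 5.3 (i), p. 65] -/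
instance : TopologicalSpace (PadicQuadAffine p) := TopologicalSpace.induced coord inferInstance

/-- The coordinate map is an embedding. [cite: MochizukiSemiAnbd2006, Def 5.3 (i), p. 65] -/
theorem isEmbedding_coord : IsEmbedding (coord (p := p)) := ⟨⟨rfl⟩, coord_injective⟩

/-- The coordinate map is continuous. [cite: MochizukiSemiAnbd2006, Def 5.3 (i), p. 65] -/
theorem continuous_coord : Continuous (coord (p := p)) := continuous_induced_dom

/-- `a.re` is continuous. [cite: MochizukiSemiAnbd2006, Def 5.3 (i), p. 65] -/
theorem continuous_are : Continuous fun g : PadicQuadAffine p => g.a.re :=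
  continuous_fst.comp (continuous_fst.comp continuous_coord)
/-- `a.im` is continuous. [cite: MochizukiSemiAnbd2006, Def 5.3 (i), p. 65] -/
theorem continuous_aim : Continuous fun g : PadicQuadAffine p => g.a.im :=
  continuous_snd.comp (continuous_fst.comp continuous_coord)
/-- `w` is continuous. [cite: MochizukiSemiAnbd2006, Def 5.3 (i), p. 65] -/
theorem continuous_w : Continuous fun g : PadicQuadAffine p => g.w :=
  continuous_fst.comp (continuous_snd.comp continuous_coord)
/-- `u` is continuous. [cite: MochizukiSemiAnbd2006, Def 5.3 (i), p. 65] -/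
theorem continuous_u : Continuous fun g : PadicQuadAffine p => g.u :=
  continuous_snd.comp (continuous_snd.comp continuous_coord)

/-- A map into the carrier is continuous iff its four coordinates are. [cite: MochizukiSemiAnbd2006, Def 5.3 (i), p. 65] -/
theorem continuous_of_coord {X : Type*} [TopologicalSpace X] {f : X → PadicQuadAffine p}
    (h1 : Continuous fun x => (f x).a.re) (h2 : Continuous fun x => (f x).a.im)
    (h3 : Continuous fun x => (f x).w) (h4 : Continuous fun x => (f x).u) : Continuous f := by
  rw [continuous_induced_rng]
  exact (h1.prodMk h2).prodMk (h3.prodMk h4)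

/-- `re (lin g)` is continuous. [cite: MochizukiSemiAnbd2006, Def 5.3 (i), p. 65] -/
theorem continuous_lin_re : Continuous fun g : PadicQuadAffine p => g.lin.re :=
  PadicQuad.continuous_re_mul (PadicQuadOneUnits.continuous_re.comp continuous_w)
    (PadicQuadOneUnits.continuous_im.comp continuous_w) (PadicQuadOneUnits.continuous_re.comp continuous_u)
    (PadicQuadOneUnits.continuous_im.comp continuous_u)

/-- `im (lin g)` is continuous. [cite: MochizukiSemiAnbd2006, Def 5.3 (i), p. 65] -/
theorem continuous_lin_im : Continuous fun g : PadicQuadAffine p => g.lin.im :=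
  PadicQuad.continuous_im_mul (PadicQuadOneUnits.continuous_re.comp continuous_w)
    (PadicQuadOneUnits.continuous_im.comp continuous_w) (PadicQuadOneUnits.continuous_re.comp continuous_u)
    (PadicQuadOneUnits.continuous_im.comp continuous_u)

/-- The carrier is a topological group. [cite: MochizukiSemiAnbd2006, Def 5.3 (i), p. 65] -/
instance : IsTopologicalGroup (PadicQuadAffine p) where
  continuous_mul := by
    apply continuous_of_coord
    · simp only [mul_a, QuadraticAlgebra.re_add]
      exact (continuous_are.comp continuous_fst).add (PadicQuad.continuous_re_mul
        (continuous_lin_re.comp continuous_fst) (continuous_lin_im.comp continuous_fst)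
        (continuous_are.comp continuous_snd) (continuous_aim.comp continuous_snd))
    · simp only [mul_a, QuadraticAlgebra.im_add]
      exact (continuous_aim.comp continuous_fst).add (PadicQuad.continuous_im_mul
        (continuous_lin_re.comp continuous_fst) (continuous_lin_im.comp continuous_fst)
        (continuous_are.comp continuous_snd) (continuous_aim.comp continuous_snd))
    · exact (continuous_w.comp continuous_fst).mul (continuous_w.comp continuous_snd)
    · exact (continuous_u.comp continuous_fst).mul (continuous_u.comp continuous_snd)
  continuous_inv := by
    have hl : (fun g : PadicQuadAffine p => g⁻¹.a) = fun g => -(g⁻¹.lin * g.a) := by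
      funext g; simp [lin]
    have hlr : Continuous fun g : PadicQuadAffine p => g⁻¹.lin.re :=
      PadicQuad.continuous_re_mul (PadicQuadOneUnits.continuous_re.comp continuous_w.inv)
        (PadicQuadOneUnits.continuous_im.comp continuous_w.inv)
        (PadicQuadOneUnits.continuous_re.comp continuous_u.inv) (PadicQuadOneUnits.continuous_im.comp continuous_u.inv)
    have hli : Continuous fun g : PadicQuadAffine p => g⁻¹.lin.im :=
      PadicQuad.continuous_im_mul (PadicQuadOneUnits.continuous_re.comp continuous_w.inv)
        (PadicQuadOneUnits.continuous_im.comp continuous_w.inv)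
        (PadicQuadOneUnits.continuous_re.comp continuous_u.inv) (PadicQuadOneUnits.continuous_im.comp continuous_u.inv)
    apply continuous_of_coord
    · have e : (fun g : PadicQuadAffine p => g⁻¹.a.re) = fun g => -(g⁻¹.lin * g.a).re := by
        funext g; simp [lin]
      rw [e]
      exact (PadicQuad.continuous_re_mul hlr hli continuous_are continuous_aim).neg
    · have e : (fun g : PadicQuadAffine p => g⁻¹.a.im) = fun g => -(g⁻¹.lin * g.a).im := by
        funext g; simp [lin]
      rw [e]
      exact (PadicQuad.continuous_im_mul hlr hli continuous_are continuous_aim).neg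
    · exact continuous_w.inv
    · exact continuous_u.inv

/-- Hausdorff. [cite: MochizukiSemiAnbd2006, Def 5.3 (i), p. 65] -/
instance : T2Space (PadicQuadAffine p) := isEmbedding_coord.t2Space

/-- Totally disconnected. [cite: MochizukiSemiAnbd2006, Def 5.3 (i), p. 65] -/
instance : TotallyDisconnectedSpace (PadicQuadAffine p) :=
  isEmbedding_coord.isTotallyDisconnected_range.mp (isTotallyDisconnected_of_totallyDisconnectedSpace _)

/-- Compact: the coordinates form the closed subset `{w real}` of a compact space.
[cite: MochizukiSemiAnbd2006, Def 5.3 (i), p. 65] -/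
instance : CompactSpace (PadicQuadAffine p) := by
  constructor
  rw [isEmbedding_coord.isInducing.isCompact_iff, image_univ, range_coord]
  have hc : Continuous fun q : (ℤ_[p] × ℤ_[p]) × (PadicQuadOneUnits p × PadicQuadOneUnits p) => q.2.1.val.im :=
    PadicQuadOneUnits.continuous_im.comp (continuous_fst.comp continuous_snd)
  exact (isClosed_eq hc continuous_const).isCompact

/-! #### The augmentation and the affine action -/

/-- The AUGMENTATION `aug : G →* U`, `(a, w, u) ↦ u` (the «arithmetic quotient» `Π_A`).
[cite: MochizukiSemiAnbd2006, Def 5.3 (i), p. 65] -/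
def aug : PadicQuadAffine p →* PadicQuadOneUnits p where
  toFun g := g.u
  map_one' := rfl
  map_mul' _ _ := rfl

/-- `aug (a, w, u) = u`. [cite: MochizukiSemiAnbd2006, Def 5.3 (i), p. 65] -/
@[simp] theorem aug_apply (g : PadicQuadAffine p) : aug g = g.u := rfl

/-- The augmentation is continuous. [cite: MochizukiSemiAnbd2006, Def 5.3 (i), p. 65] -/
theorem continuous_aug : Continuous (aug (p := p)) := continuous_u

/-- The section `u ↦ (0, 1, u)` of the augmentation. [cite: MochizukiSemiAnbd2006, Def 5.3 (i), p. 65] -/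
def ofUnit (u : PadicQuadOneUnits p) : PadicQuadAffine p := ⟨0, 1, u, by simp [QuadraticAlgebra.im_one]⟩

/-- `aug (ofUnit u) = u`. [cite: MochizukiSemiAnbd2006, Def 5.3 (i), p. 65] -/
@[simp] theorem aug_ofUnit (u : PadicQuadOneUnits p) : aug (ofUnit u) = u := rfl

/-- The augmentation is surjective. [cite: MochizukiSemiAnbd2006, Def 5.3 (i), p. 65] -/
theorem aug_surjective : Function.Surjective (aug (p := p)) := fun u => ⟨ofUnit u, rfl⟩

/-- The affine action on `R`: `(a, w, u) · y = w u y + a`. [cite: MochizukiSemiAnbd2006, Def 5.3 (ii), p. 65] -/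
def act (g : PadicQuadAffine p) (y : PadicQuad p) : PadicQuad p := g.lin * y + g.a

/-- `(g h) · y = g · (h · y)`. [cite: MochizukiSemiAnbd2006, Def 5.3 (ii), p. 65] -/
theorem act_mul (g h : PadicQuadAffine p) (y : PadicQuad p) : act (g * h) y = act g (act h y) := by
  simp only [act, mul_a, lin_mul]; ring

/-- `1 · y = y`. [cite: MochizukiSemiAnbd2006, Def 5.3 (ii), p. 65] -/
@[simp] theorem act_one (y : PadicQuad p) : act 1 y = y := by simp [act]

/-- `g⁻¹ · (g · y) = y`. [cite: MochizukiSemiAnbd2006, Def 5.3 (ii), p. 65] -/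
@[simp] theorem act_inv_act (g : PadicQuadAffine p) (y : PadicQuad p) : act g⁻¹ (act g y) = y := by
  rw [← act_mul, inv_mul_cancel, act_one]

/-- The STABILISER `Stab(y) = {g : g · y = y}` of a point `y ∈ R` — the decomposition group of the
«cusp» `y`. [cite: MochizukiSemiAnbd2006, Def 5.3 (ii), p. 65] -/
def stab (y : PadicQuad p) : Subgroup (PadicQuadAffine p) where
  carrier := {g | act g y = y}
  mul_mem' {g h} hg hh := by
    simp only [mem_setOf_eq] at hg hh ⊢
    rw [act_mul, hh, hg]
  one_mem' := act_one y
  inv_mem' {g} hg := by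
    simp only [mem_setOf_eq] at hg ⊢
    conv_lhs => rw [← hg]
    exact act_inv_act g y

/-- Membership in a stabiliser. [cite: MochizukiSemiAnbd2006, Def 5.3 (ii), p. 65] -/
@[simp] theorem mem_stab_iff (y : PadicQuad p) (g : PadicQuadAffine p) : g ∈ stab y ↔ act g y = y := Iff.rfl

/-- `g · Stab(y) · g⁻¹ = Stab(g · y)`. [cite: MochizukiSemiAnbd2006, Def 5.3 (ii), p. 65] -/
theorem stab_map_conj (g : PadicQuadAffine p) (y : PadicQuad p) :
    (stab y).map (MulAut.conj g).toMonoidHom = stab (act g y) := by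
  ext k
  simp only [Subgroup.mem_map, mem_stab_iff, MulEquiv.coe_toMonoidHom, MulAut.conj_apply]
  constructor
  · rintro ⟨h, hh, rfl⟩
    rw [act_mul, act_mul, act_inv_act, hh]
  · intro hk
    refine ⟨g⁻¹ * k * g, ?_, by group⟩
    rw [act_mul, act_mul, hk, act_inv_act]

end PadicQuadAffine

end Literature.GroupTheory.SpecificGroups
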